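import Summits.QuantumFields.YangMills.Theorems.UnitScaleTiltProp7AccumulatedFrameStep
import Summits.QuantumFields.YangMills.Theorems.UnitScaleTiltProp7BlockMeanContraction
import HarnessLib

/-!
# Route `UnitScaleTilt`, crux K1 «MinimiserStabilityRegPr» (stmt-QuantumFields-19200), route-R E′ (A′) «HCOW-VIA-Σ», row P-A2 «JOINT-Σ», file F3″-B2c —
# THE ONE-STEP ACCUMULATED-FRAME INEQUALITY IN `ℓ²` (generic level `k`, every input displayed):
# `Φ_{k+1} ≤ 4((L^d)⁻¹ + 180t*²)·Φ_k + 4(1 + 6t*)²·C_R²·Σ_y B(y)`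

Cell `ym3-torus`, width seat `ym3-torus-px22` (gen 3); ★p1 g17 WORD 10 (4) «F3″ → px22»; LOCATE `LOCATE-PA2-F3-LEVELMASSES-px22g3.md` §5.  THE POINT.  Pointwise, ✓ `Prop7AccumulatedFrameStep.
norm_frameAccU_succ_sub_one_le` gives `‖v_{k+1}(y) − 1‖ ≤ mean_i(‖R_i − 1‖ + ‖a_i − 1‖) + 6t²`.  Here the three inputs are DISPLAYED per level: the frames and the background stair
transports are bi-contractive (U1), the frames are within `δ₂` of `1` (sup), and the single-bar stair ratios obey `‖R_i(y) − 1‖ ≤ C_R·√B(y)` with `C_R√B(y) ≤ ρ` (at T³: `B(y)` = the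
single-bar level mass of the block, by ✓ `Prop7HolRatioWalkSum.norm_holRatio_sub_one_le_walkSum` + lit ✓ `stair_src_tgt_blockOf`).  Then `‖a_i − 1‖ ≤ ‖v_k(x_i) − 1‖` (unitary conjugation),
the local `t_y ≤ min(t*, C_R√B(y) + √V(y) + 2‖v_k(emb y) − 1‖)` (`t* = ρ + 3δ₂ ≤ ¼`, `V(y)` the frame mass of the block), `(a+b+c+d)² ≤ 4Σ`, and the three `ℓ²` letters — ✓ `Prop7BlockMeanContraction.
sum_sq_idxMean_le` (`(L^d)⁻¹·Φ_k`), the block tiling (`Σ_y V(y) = Φ_k`), `emb` injective (`Σ_y ‖v(emb y) − 1‖² ≤ Φ_k`) — give the title row: the `hΦ` hypothesis of ✓ `Prop7TwistedLevelMassInduction.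
frameMass_induction` with `q = 4((L^d)⁻¹ + 180t*²)`, `C·M_k = 4(1+6t*)²C_R²·Σ_y B(y)`.  THEOREMS ONLY (0 `def`, 0 `sorry`); `--supports stmt-QuantumFields-19200`, count-neutral.
YM₃ on T³ is a ladder rung (R3), not the Clay problem; nothing here claims the stub, the crux, d = 4 or the gap.

References: T. Bałaban, CMP 98 (1985) 17–51 [Balaban1985Averaging] ((82) p.30, (89) p.31, (97) p.32, Prop. 3 (122)–(126) p.36); CMP 109 (1987) 249–301 [Balaban1987RG1] ((0.3)–(0.4) pp.252–253).
-/

set_option autoImplicit false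

noncomputable section

open scoped BigOperators

namespace Summit.QuantumFields.YangMills.Theorems.Prop7FrameMassStep

open Finset
open Literature.MathematicalPhysics.QuantumFieldTheory.Balaban1983to89
open T4Continuum T4ReflectionCone BlockAveraging AveragingRT
open B10Eq27TorusAxialLog (holT transl)
open B7Prop1Explicit (disp)
open Summit.QuantumFields.YangMills.Theorems.Prop8Chart (emlIterU)
open Summit.QuantumFields.YangMills.Theorems.Prop7SymAvgTwSym (tstairU frameAccU)
open Summit.QuantumFields.YangMills.Theorems.Prop7AccumulatedFrameStep (norm_frameAccU_succ_sub_one_le tstairU_eq_frame_inv_mul norm_inv_mul_sub_one_le)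
open Summit.QuantumFields.YangMills.Theorems.Prop7BlockMeanContraction (transl_emb_disp_stairWord_eq_blockSite sum_sq_idxMean_le sum_sum_block_eq)
open Summit.QuantumFields.YangMills.Theorems.LinearLiftGauge (sum_blockSite_eq)

variable {P : Params} {𝔸 : Type*} [NormedRing 𝔸] [NormedAlgebra ℂ 𝔸] [CompleteSpace 𝔸] {k : ℕ}

omit [NormedAlgebra ℂ 𝔸] [CompleteSpace 𝔸] in
/-- conjugation by a bi-contractive unit does not increase `‖· − 1‖`: `‖νvν⁻¹ − 1‖ ≤ ‖v − 1‖`. [folklore] -/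
theorem norm_conj_sub_one_le (ν v : 𝔸ˣ) (h1 : ‖(ν : 𝔸)‖ ≤ 1) (h2 : ‖((ν⁻¹ : 𝔸ˣ) : 𝔸)‖ ≤ 1) :
    ‖((ν * v * ν⁻¹ : 𝔸ˣ) : 𝔸) - 1‖ ≤ ‖(v : 𝔸) - 1‖ := by
  have e : ((ν * v * ν⁻¹ : 𝔸ˣ) : 𝔸) - 1 = (ν : 𝔸) * ((v : 𝔸) - 1) * ((ν⁻¹ : 𝔸ˣ) : 𝔸) := by
    rw [mul_sub, sub_mul, mul_one, Units.mul_inv]; simp only [Units.val_mul]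
  rw [e]
  calc ‖(ν : 𝔸) * ((v : 𝔸) - 1) * ((ν⁻¹ : 𝔸ˣ) : 𝔸)‖ ≤ ‖(ν : 𝔸)‖ * ‖(v : 𝔸) - 1‖ * ‖((ν⁻¹ : 𝔸ˣ) : 𝔸)‖ :=
        (norm_mul_le _ _).trans (mul_le_mul_of_nonneg_right (norm_mul_le _ _) (norm_nonneg _))
    _ ≤ 1 * ‖(v : 𝔸) - 1‖ * 1 := by gcongr
    _ = ‖(v : 𝔸) - 1‖ := by ring

omit [NormedAlgebra ℂ 𝔸] [CompleteSpace 𝔸] in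
/-- a bi-contractive conjugate of a contractive unit is contractive. [folklore] -/
theorem norm_conj_le_one (ν v : 𝔸ˣ) (h1 : ‖(ν : 𝔸)‖ ≤ 1) (h2 : ‖((ν⁻¹ : 𝔸ˣ) : 𝔸)‖ ≤ 1) (hv : ‖(v : 𝔸)‖ ≤ 1) :
    ‖((ν * v * ν⁻¹ : 𝔸ˣ) : 𝔸)‖ ≤ 1 := by
  simp only [Units.val_mul]
  calc ‖(ν : 𝔸) * (v : 𝔸) * ((ν⁻¹ : 𝔸ˣ) : 𝔸)‖ ≤ ‖(ν : 𝔸)‖ * ‖(v : 𝔸)‖ * ‖((ν⁻¹ : 𝔸ˣ) : 𝔸)‖ :=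
        (norm_mul_le _ _).trans (mul_le_mul_of_nonneg_right (norm_mul_le _ _) (norm_nonneg _))
    _ ≤ 1 * 1 * 1 := by gcongr
    _ = 1 := by ring

/-- `emb` is injective in the standing range (`blockOf ∘ emb = id`). [cite: Balaban1987RG1, (0.3) p.252] -/
theorem sum_emb_le (hk : k + 1 ≤ P.m + P.K) (g : Site P k → ℝ) (hg : ∀ x, 0 ≤ g x) :
    ∑ y : Site P (k + 1), g (emb y) ≤ ∑ x : Site P k, g x := by
  have hinj : Function.Injective (emb : Site P (k + 1) → Site P k) :=
    Function.LeftInverse.injective (g := blockOf) fun y => Site.blockOf_emb hk y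
  rw [← Finset.sum_image (f := g) (s := Finset.univ) (g := emb) fun y _ y' _ h => hinj h]
  exact Finset.sum_le_sum_of_subset_of_nonneg (Finset.subset_univ _) fun x _ _ => hg x

/-- ★★★ **THE ONE-STEP ACCUMULATED-FRAME INEQUALITY IN `ℓ²`** (see the module docstring): with `v_k = frameAccU k U₀ W`, `st_i = stairWord i.2.1 (off i.1)`,
`ν_i(y) = Ū₀⁽ᵏ⁾(st_i)`, `R_i(y) = Ū⁽ᵏ⁾(st_i)·ν_i(y)⁻¹`, displayed U1∕sup∕stair rows and the window `t* := ρ + 3δ₂ ≤ ¼`: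
`Σ_y ‖v_{k+1}(y) − 1‖² ≤ 4((L^d)⁻¹ + 180t*²)·Σ_x ‖v_k(x) − 1‖² + 4(1+6t*)²·C_R²·Σ_y B(y)`. [cite: Balaban1985Averaging, (82) p.30, (97) p.32, Prop. 3 (122)-(126) p.36] -/
theorem frameMass_step_le (hk : k + 1 ≤ P.m + P.K) (U₀ W : GaugeField P 0 𝔸ˣ) {δ₂ ρ CR : ℝ} (B : Site P (k + 1) → ℝ)
    (hCR : 0 ≤ CR) (hB0 : ∀ y, 0 ≤ B y) (hδ₂ : 0 ≤ δ₂) (hρ : 0 ≤ ρ)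
    (hv1 : ∀ x : Site P k, ‖(frameAccU k U₀ W x : 𝔸)‖ ≤ 1)
    (hv1' : ∀ x : Site P k, ‖(((frameAccU k U₀ W x)⁻¹ : 𝔸ˣ) : 𝔸)‖ ≤ 1)
    (hν : ∀ (y : Site P (k + 1)) (i : Idx P), ‖((holT (emlIterU k U₀) (emb y) (stairWord i.2.1 (off i.1)) : 𝔸ˣ) : 𝔸)‖ ≤ 1 ∧
      ‖(((holT (emlIterU k U₀) (emb y) (stairWord i.2.1 (off i.1)))⁻¹ : 𝔸ˣ) : 𝔸)‖ ≤ 1)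
    (hv2 : ∀ x : Site P k, ‖(frameAccU k U₀ W x : 𝔸) - 1‖ ≤ δ₂)
    (hR : ∀ (y : Site P (k + 1)) (i : Idx P),
      ‖((holT (emlIterU k W) (emb y) (stairWord i.2.1 (off i.1)) * (holT (emlIterU k U₀) (emb y) (stairWord i.2.1 (off i.1)))⁻¹ : 𝔸ˣ) : 𝔸) - 1‖ ≤ CR * Real.sqrt (B y))
    (hρB : ∀ y, CR * Real.sqrt (B y) ≤ ρ) (ht : ρ + 3 * δ₂ ≤ 1 / 4) :
    ∑ y : Site P (k + 1), ‖(frameAccU (k + 1) U₀ W y : 𝔸) - 1‖ ^ 2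
      ≤ 4 * (((P.L : ℝ) ^ P.d)⁻¹ + 180 * (ρ + 3 * δ₂) ^ 2) * ∑ x : Site P k, ‖(frameAccU k U₀ W x : 𝔸) - 1‖ ^ 2
        + 4 * (1 + 6 * (ρ + 3 * δ₂)) ^ 2 * CR ^ 2 * ∑ y : Site P (k + 1), B y := by
  have ht0 : 0 ≤ ρ + 3 * δ₂ := by positivity
  -- the pointwise bound at every coarse site
  have hpt : ∀ y : Site P (k + 1), ‖(frameAccU (k + 1) U₀ W y : 𝔸) - 1‖
      ≤ (1 + 6 * (ρ + 3 * δ₂)) * (CR * Real.sqrt (B y))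
        + (Fintype.card (Idx P) : ℝ)⁻¹ * ∑ i : Idx P, ‖(frameAccU k U₀ W (transl (emb y) (disp (stairWord i.2.1 (off i.1)))) : 𝔸) - 1‖
        + 6 * (ρ + 3 * δ₂) * Real.sqrt (∑ r : Fin P.d → Fin P.L, ‖(frameAccU k U₀ W (Site.blockSite y r) : 𝔸) - 1‖ ^ 2)
        + 12 * (ρ + 3 * δ₂) * ‖(frameAccU k U₀ W (emb y) : 𝔸) - 1‖ := by
    intro y
    have hcard : (0 : ℝ) < Fintype.card (Idx P) := Nat.cast_pos.2 Fintype.card_pos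
    -- letters at `y`
    have hVi : ∀ i : Idx P, ‖(frameAccU k U₀ W (transl (emb y) (disp (stairWord i.2.1 (off i.1)))) : 𝔸) - 1‖
        ≤ Real.sqrt (∑ r : Fin P.d → Fin P.L, ‖(frameAccU k U₀ W (Site.blockSite y r) : 𝔸) - 1‖ ^ 2) := by
      intro i
      rw [transl_emb_disp_stairWord_eq_blockSite, ← Real.sqrt_sq (norm_nonneg _)]
      exact Real.sqrt_le_sqrt (Finset.single_le_sum (f := fun r => ‖(frameAccU k U₀ W (Site.blockSite y r) : 𝔸) - 1‖ ^ 2)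
        (fun r _ => sq_nonneg _) (Finset.mem_univ i.1))
    have ha1 : ∀ i : Idx P, ‖((holT (emlIterU k U₀) (emb y) (stairWord i.2.1 (off i.1)) * frameAccU k U₀ W (transl (emb y) (disp (stairWord i.2.1 (off i.1))))
            * (holT (emlIterU k U₀) (emb y) (stairWord i.2.1 (off i.1)))⁻¹ : 𝔸ˣ) : 𝔸) - 1‖
        ≤ ‖(frameAccU k U₀ W (transl (emb y) (disp (stairWord i.2.1 (off i.1)))) : 𝔸) - 1‖ :=
      fun i => norm_conj_sub_one_le _ _ (hν y i).1 (hν y i).2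
    have ha : ∀ i : Idx P, ‖((holT (emlIterU k U₀) (emb y) (stairWord i.2.1 (off i.1)) * frameAccU k U₀ W (transl (emb y) (disp (stairWord i.2.1 (off i.1))))
            * (holT (emlIterU k U₀) (emb y) (stairWord i.2.1 (off i.1)))⁻¹ : 𝔸ˣ) : 𝔸)‖ ≤ 1 :=
      fun i => norm_conj_le_one _ _ (hν y i).1 (hν y i).2 (hv1 _)
    have hvc2 : ‖(((frameAccU k U₀ W (emb y))⁻¹ : 𝔸ˣ) : 𝔸) - 1‖ ≤ 2 * ‖(frameAccU k U₀ W (emb y) : 𝔸) - 1‖ :=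
      B7Prop6Flat.norm_units_inv_sub_one_le _ ((hv2 _).trans (by linarith))
    -- the local sup `t_y ≤ min (t*) (T_y)`, used as `6 t_y² ≤ 6 t* T_y`
    set Ty : ℝ := CR * Real.sqrt (B y) + Real.sqrt (∑ r : Fin P.d → Fin P.L, ‖(frameAccU k U₀ W (Site.blockSite y r) : 𝔸) - 1‖ ^ 2)
        + 2 * ‖(frameAccU k U₀ W (emb y) : 𝔸) - 1‖ with hTy
    have hTy0 : 0 ≤ Ty := by rw [hTy]; positivity
    have htst : ∀ i : Idx P, ‖((tstairU (emlIterU k U₀) (Summit.QuantumFields.YangMills.Theorems.Prop7SymAvgTwSym.dbarCovIterU k U₀ W) y i : 𝔸ˣ) : 𝔸) - 1‖ ≤ min (ρ + 3 * δ₂) Ty := by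
      intro i
      rw [tstairU_eq_frame_inv_mul, Units.val_mul]
      refine (norm_inv_mul_sub_one_le _ (hv1' _) _).trans ?_
      rw [Units.val_mul]
      have h3 : ‖((holT (emlIterU k W) (emb y) (stairWord i.2.1 (off i.1)) * (holT (emlIterU k U₀) (emb y) (stairWord i.2.1 (off i.1)))⁻¹ : 𝔸ˣ) : 𝔸)
          * ((holT (emlIterU k U₀) (emb y) (stairWord i.2.1 (off i.1)) * frameAccU k U₀ W (transl (emb y) (disp (stairWord i.2.1 (off i.1))))
            * (holT (emlIterU k U₀) (emb y) (stairWord i.2.1 (off i.1)))⁻¹ : 𝔸ˣ) : 𝔸) - 1‖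
          ≤ CR * Real.sqrt (B y) + ‖(frameAccU k U₀ W (transl (emb y) (disp (stairWord i.2.1 (off i.1)))) : 𝔸) - 1‖ := by
        have e : ∀ R a : 𝔸, R * a - 1 = (R - 1) * a + (a - 1) := fun R a => by noncomm_ring
        rw [e]
        refine (norm_add_le _ _).trans (add_le_add ?_ (ha1 i))
        exact (norm_mul_le _ _).trans ((mul_le_mul (hR y i) (ha i) (norm_nonneg _) (by positivity)).trans (le_of_eq (mul_one _)))
      refine le_min ?_ ?_
      · have := hVi i
        linarith [hv2 (transl (emb y) (disp (stairWord i.2.1 (off i.1)))), hv2 (emb y), hρB y]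
      · rw [hTy]; linarith [hVi i]
    have hmin4 : min (ρ + 3 * δ₂) Ty ≤ 1 / 4 := (min_le_left _ _).trans ht
    have hB1 := norm_frameAccU_succ_sub_one_le k U₀ W y (hv1 _) ha htst hmin4
    -- `6·min² ≤ 6·t*·T_y`
    have hmin2 : 6 * (min (ρ + 3 * δ₂) Ty) ^ 2 ≤ 6 * (ρ + 3 * δ₂) * Ty := by
      have hm0 : 0 ≤ min (ρ + 3 * δ₂) Ty := le_min ht0 hTy0
      have := mul_le_mul (min_le_left (ρ + 3 * δ₂) Ty) (min_le_right (ρ + 3 * δ₂) Ty) hm0 ht0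
      nlinarith
    -- the mean of the stair terms and of the end-frame terms
    have hmeanR : (Fintype.card (Idx P) : ℝ)⁻¹ * ∑ i : Idx P,
        (‖((holT (emlIterU k W) (emb y) (stairWord i.2.1 (off i.1)) * (holT (emlIterU k U₀) (emb y) (stairWord i.2.1 (off i.1)))⁻¹ : 𝔸ˣ) : 𝔸) - 1‖
          + ‖((holT (emlIterU k U₀) (emb y) (stairWord i.2.1 (off i.1)) * frameAccU k U₀ W (transl (emb y) (disp (stairWord i.2.1 (off i.1))))
            * (holT (emlIterU k U₀) (emb y) (stairWord i.2.1 (off i.1)))⁻¹ : 𝔸ˣ) : 𝔸) - 1‖)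
        ≤ CR * Real.sqrt (B y) + (Fintype.card (Idx P) : ℝ)⁻¹ * ∑ i : Idx P, ‖(frameAccU k U₀ W (transl (emb y) (disp (stairWord i.2.1 (off i.1)))) : 𝔸) - 1‖ := by
      rw [Finset.sum_add_distrib, mul_add]
      refine add_le_add ?_ (mul_le_mul_of_nonneg_left (Finset.sum_le_sum fun i _ => ha1 i) (by positivity))
      calc (Fintype.card (Idx P) : ℝ)⁻¹ * ∑ i : Idx P, ‖((holT (emlIterU k W) (emb y) (stairWord i.2.1 (off i.1)) * (holT (emlIterU k U₀) (emb y) (stairWord i.2.1 (off i.1)))⁻¹ : 𝔸ˣ) : 𝔸) - 1‖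
          ≤ (Fintype.card (Idx P) : ℝ)⁻¹ * ∑ _i : Idx P, CR * Real.sqrt (B y) :=
            mul_le_mul_of_nonneg_left (Finset.sum_le_sum fun i _ => hR y i) (by positivity)
        _ = CR * Real.sqrt (B y) := by
            rw [Finset.sum_const, Finset.card_univ, nsmul_eq_mul, ← mul_assoc, inv_mul_cancel₀ hcard.ne', one_mul]
    have := hB1.trans (add_le_add hmeanR hmin2)
    rw [hTy] at this
    linarith
  -- square and sum
  have hsq : ∀ y : Site P (k + 1), ‖(frameAccU (k + 1) U₀ W y : 𝔸) - 1‖ ^ 2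
      ≤ 4 * (((1 + 6 * (ρ + 3 * δ₂)) * (CR * Real.sqrt (B y))) ^ 2
        + ((Fintype.card (Idx P) : ℝ)⁻¹ * ∑ i : Idx P, ‖(frameAccU k U₀ W (transl (emb y) (disp (stairWord i.2.1 (off i.1)))) : 𝔸) - 1‖) ^ 2
        + (6 * (ρ + 3 * δ₂) * Real.sqrt (∑ r : Fin P.d → Fin P.L, ‖(frameAccU k U₀ W (Site.blockSite y r) : 𝔸) - 1‖ ^ 2)) ^ 2
        + (12 * (ρ + 3 * δ₂) * ‖(frameAccU k U₀ W (emb y) : 𝔸) - 1‖) ^ 2) := by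
    intro y
    have h0 : 0 ≤ ‖(frameAccU (k + 1) U₀ W y : 𝔸) - 1‖ := norm_nonneg _
    -- `(a+b+c+e)² ≤ 4(a²+b²+c²+e²)` (cf. ✓ `MatomakiRadziwillThm3.sq_add_four_le`)
    have h4sq : ∀ a b c e : ℝ, (a + b + c + e) ^ 2 ≤ 4 * (a ^ 2 + b ^ 2 + c ^ 2 + e ^ 2) := fun a b c e => by
      nlinarith [sq_nonneg (a - b), sq_nonneg (a - c), sq_nonneg (a - e), sq_nonneg (b - c), sq_nonneg (b - e), sq_nonneg (c - e)]
    exact (pow_le_pow_left₀ h0 (hpt y) 2).trans (h4sq _ _ _ _)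
  refine (Finset.sum_le_sum fun y _ => hsq y).trans ?_
  -- evaluate the four sums
  have e1 : ∀ y : Site P (k + 1), ((1 + 6 * (ρ + 3 * δ₂)) * (CR * Real.sqrt (B y))) ^ 2 = (1 + 6 * (ρ + 3 * δ₂)) ^ 2 * CR ^ 2 * B y := fun y => by
    rw [mul_pow, mul_pow, Real.sq_sqrt (hB0 y)]; ring
  have e3 : ∀ y : Site P (k + 1), (6 * (ρ + 3 * δ₂) * Real.sqrt (∑ r : Fin P.d → Fin P.L, ‖(frameAccU k U₀ W (Site.blockSite y r) : 𝔸) - 1‖ ^ 2)) ^ 2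
      = 36 * (ρ + 3 * δ₂) ^ 2 * ∑ r : Fin P.d → Fin P.L, ‖(frameAccU k U₀ W (Site.blockSite y r) : 𝔸) - 1‖ ^ 2 := fun y => by
    rw [mul_pow, mul_pow, Real.sq_sqrt (Finset.sum_nonneg fun r _ => sq_nonneg _)]; ring
  have e4 : ∀ y : Site P (k + 1), (12 * (ρ + 3 * δ₂) * ‖(frameAccU k U₀ W (emb y) : 𝔸) - 1‖) ^ 2 = 144 * (ρ + 3 * δ₂) ^ 2 * ‖(frameAccU k U₀ W (emb y) : 𝔸) - 1‖ ^ 2 :=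
    fun y => by ring
  simp only [e1, e3, e4]
  -- split the sum of the four squares
  have key : ∀ y : Site P (k + 1),
      4 * ((1 + 6 * (ρ + 3 * δ₂)) ^ 2 * CR ^ 2 * B y
        + ((Fintype.card (Idx P) : ℝ)⁻¹ * ∑ i : Idx P, ‖(frameAccU k U₀ W (transl (emb y) (disp (stairWord i.2.1 (off i.1)))) : 𝔸) - 1‖) ^ 2
        + 36 * (ρ + 3 * δ₂) ^ 2 * ∑ r : Fin P.d → Fin P.L, ‖(frameAccU k U₀ W (Site.blockSite y r) : 𝔸) - 1‖ ^ 2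
        + 144 * (ρ + 3 * δ₂) ^ 2 * ‖(frameAccU k U₀ W (emb y) : 𝔸) - 1‖ ^ 2)
      = 4 * ((1 + 6 * (ρ + 3 * δ₂)) ^ 2 * CR ^ 2) * B y
        + 4 * ((Fintype.card (Idx P) : ℝ)⁻¹ * ∑ i : Idx P, ‖(frameAccU k U₀ W (transl (emb y) (disp (stairWord i.2.1 (off i.1)))) : 𝔸) - 1‖) ^ 2
        + (144 * (ρ + 3 * δ₂) ^ 2) * ∑ r : Fin P.d → Fin P.L, ‖(frameAccU k U₀ W (Site.blockSite y r) : 𝔸) - 1‖ ^ 2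
        + (576 * (ρ + 3 * δ₂) ^ 2) * ‖(frameAccU k U₀ W (emb y) : 𝔸) - 1‖ ^ 2 := fun y => by ring
  simp only [key, Finset.sum_add_distrib, ← Finset.mul_sum]
  -- the four `ℓ²` letters
  have h2 := sum_sq_idxMean_le hk (fun x => ‖(frameAccU k U₀ W x : 𝔸) - 1‖)
  have h3 : ∑ y : Site P (k + 1), ∑ r : Fin P.d → Fin P.L, ‖(frameAccU k U₀ W (Site.blockSite y r) : 𝔸) - 1‖ ^ 2 = ∑ x : Site P k, ‖(frameAccU k U₀ W x : 𝔸) - 1‖ ^ 2 := by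
    calc ∑ y : Site P (k + 1), ∑ r : Fin P.d → Fin P.L, ‖(frameAccU k U₀ W (Site.blockSite y r) : 𝔸) - 1‖ ^ 2
        = ∑ y : Site P (k + 1), ∑ x ∈ block y, ‖(frameAccU k U₀ W x : 𝔸) - 1‖ ^ 2 :=
          Finset.sum_congr rfl fun y _ => sum_blockSite_eq hk y (fun x => ‖(frameAccU k U₀ W x : 𝔸) - 1‖ ^ 2)
      _ = ∑ x : Site P k, ‖(frameAccU k U₀ W x : 𝔸) - 1‖ ^ 2 := sum_sum_block_eq _
  have h4 := sum_emb_le hk (fun x => ‖(frameAccU k U₀ W x : 𝔸) - 1‖ ^ 2) fun x => sq_nonneg _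
  have hΦ0 : 0 ≤ ∑ x : Site P k, ‖(frameAccU k U₀ W x : 𝔸) - 1‖ ^ 2 := Finset.sum_nonneg fun x _ => sq_nonneg _
  have ht2 : 0 ≤ (ρ + 3 * δ₂) ^ 2 := sq_nonneg _
  rw [h3]
  have s2 : 4 * ∑ y : Site P (k + 1), ((Fintype.card (Idx P) : ℝ)⁻¹ * ∑ i : Idx P, ‖(frameAccU k U₀ W (transl (emb y) (disp (stairWord i.2.1 (off i.1)))) : 𝔸) - 1‖) ^ 2
      ≤ 4 * (((P.L : ℝ) ^ P.d)⁻¹ * ∑ x : Site P k, ‖(frameAccU k U₀ W x : 𝔸) - 1‖ ^ 2) := mul_le_mul_of_nonneg_left h2 (by norm_num)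
  have s4 : 576 * (ρ + 3 * δ₂) ^ 2 * ∑ y : Site P (k + 1), ‖(frameAccU k U₀ W (emb y) : 𝔸) - 1‖ ^ 2
      ≤ 576 * (ρ + 3 * δ₂) ^ 2 * ∑ x : Site P k, ‖(frameAccU k U₀ W x : 𝔸) - 1‖ ^ 2 := mul_le_mul_of_nonneg_left h4 (by positivity)
  have etot : 4 * (((P.L : ℝ) ^ P.d)⁻¹ + 180 * (ρ + 3 * δ₂) ^ 2) * ∑ x : Site P k, ‖(frameAccU k U₀ W x : 𝔸) - 1‖ ^ 2
      = 4 * (((P.L : ℝ) ^ P.d)⁻¹ * ∑ x : Site P k, ‖(frameAccU k U₀ W x : 𝔸) - 1‖ ^ 2)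
        + 144 * (ρ + 3 * δ₂) ^ 2 * ∑ x : Site P k, ‖(frameAccU k U₀ W x : 𝔸) - 1‖ ^ 2
        + 576 * (ρ + 3 * δ₂) ^ 2 * ∑ x : Site P k, ‖(frameAccU k U₀ W x : 𝔸) - 1‖ ^ 2 := by ring
  rw [etot]
  linarith [s2, s4]

end Summit.QuantumFields.YangMills.Theorems.Prop7FrameMassStep

end
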